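import Literature.NumberTheory.Automorphic.UnitaryGroupTruncatedKernelClassDifference
import Literature.NumberTheory.Automorphic.UnitaryGroupTruncatedKernelHighCuspTwo
import HarnessLib

/-!
# The difference of two class truncated kernels on `U(J₂)`: `k^{T'}_𝔬(x) − k^{T}_𝔬(x)` is the pseudo-Eisenstein
# series of the class window `1_{T < H ≤ T'} K_{B,𝔬}`
(Rogawski, *Automorphic Representations of Unitary Groups in Three Variables* (1990), §2.2–2.3 pp. 13–14, for the
rank-one groups `U(3)`, `U(2)`, `U(2) × U(1)` of §7.3 p. 98; Arthur, *The trace formula in invariant form*, Ann. of Math.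
114 (1981), Prop. 2.3: `J^T_𝔬(f)` is a polynomial in `T`, read off the difference `J^{T'}_𝔬 − J^{T}_𝔬`.)

Topic `NumberTheory/Automorphic`; namespace `Literature.NumberTheory.Automorphic.UnitaryGroup`. THEOREMS ONLY over
accepted tree modules: no definition, no named fact, no instance, no notation, no `sorry`. The `N = 2` sibling of the
`section Three` heads of ★ `UnitaryGroupTruncatedKernelClassDifference` (whose `section General` — the class window
`classWindow_*` lemmas and `kernelBorelTailClass_sub_kernelBorelTailClass`, every `N` — is USED); the only `N`-dependent
input is the Siegel property ★ `not_lt_borelHeight_mul_of_not_mem_arithmeticBorel_two`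
(`UnitaryGroupTruncatedKernelHighCuspTwo`). H-SIDE copy of LAWS 1–5 (`H = U(Φ₂) × U(Φ₁)`; LEAD WORDs #123∕#124; census
`CENSUS-LAWS-Hside.F0P3a-p03g6.md` §3 LAW 2∕LAW 3 «class rows first» — the per-class window identity from which
`J^T_𝔬(f) = A log T + B` on `U(J₂)` is read) of the T1 line `Cruxes/H413/Lines/F0_T1InnerFormTraceIdentity.lean`
(cell `pub/hodgecm-mathlib`, crux H413).

* §2 `truncatedKernelClass_eq_kernelClass_sub_of_lt_two` (`k^T_𝔬 = K_𝔬 − K_{B,𝔬}` for `1 ≤ T < H(g)`, granted the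
  `B(F)`-invariance `hK`), `pseudoEisenstein_classWindow_eq_self_two`, `pseudoEisenstein_classWindow_eq_zero_two`,
  `pseudoEisenstein_classWindow_rational_mul_two`;
* §3 `truncatedKernelClass_sub_truncatedKernelClass_eq_of_lt_two`, `truncatedKernelClass_sub_truncatedKernelClass_eq_zero_two`,
  **`truncatedKernelClass_sub_truncatedKernelClass_two`** —
  `k^{T'}_𝔬(x) − k^{T}_𝔬(x) = Σ_{δ ∈ B(F)\G(F)} 1_{T < H(δx) ≤ T'} K_{B,𝔬}(δx, δx)` for `1 ≤ T ≤ T'` and every `x`.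

## References

* J. D. Rogawski, *Automorphic Representations of Unitary Groups in Three Variables*, Ann. of Math. Stud. 123 (1990),
  §2.2–2.3 (pp. 13–14), §7.3 (p. 98) [Rogawski1990].
* J. Arthur, *The trace formula in invariant form*, Ann. of Math. 114 (1981), Prop. 2.3
  [Arthur1981TraceFormulaInvariantForm].
-/

set_option autoImplicit false

noncomputable section

open MeasureTheory Measure NumberField IsDedekindDomain Matrix Topology
open scoped NNReal ENNReal MatrixGroups

namespace Literature.NumberTheory.Automorphic

namespace UnitaryGroup

variable {F E : Type} [Field F] [NumberField F] [Field E] [NumberField E] [Algebra F E]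
  {c : E ≃ₐ[F] E} {ι : Type*}

section Two

variable [MeasurableSpace (adelicUnipotent F E c 2)]

/-! ## §2 High in the cusp: `k^T_𝔬 = K_𝔬 − K_{B,𝔬}`; the class window's pseudo-Eisenstein series -/

/-- **`k^T_𝔬(g) = K_𝔬(g,g) − K_{B,𝔬}(g,g)` for `1 ≤ T < H(g)`** on `U(J₂)`, granted `hK`: only `δ = 1` survives in the
pseudo-Eisenstein series of the class tail (Siegel property ★ `not_lt_borelHeight_mul_of_not_mem_arithmeticBorel_two`).
[cite: Rogawski1990, §2.2 (p. 13)] -/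
theorem truncatedKernelClass_eq_kernelClass_sub_of_lt_two {ν : Measure (adelicUnipotent F E c 2)}
    {𝓕 : Set (adelicUnipotent F E c 2)} {cl : (quasiSplit F E c 2).arithmeticSubgroup → ι} {i : ι}
    {f : (quasiSplit F E c 2).Adelic → ℂ}
    (hK : ∀ b ∈ arithmeticBorel F E c 2, ∀ y : (quasiSplit F E c 2).Adelic,
      kernelBorelClass ν 𝓕 cl i f ((b : (quasiSplit F E c 2).Adelic) * y)
        ((b : (quasiSplit F E c 2).Adelic) * y) = kernelBorelClass ν 𝓕 cl i f y y)
    {T : ℝ≥0} (hT : 1 ≤ T) {g : (quasiSplit F E c 2).Adelic} (hg : T < borelHeight g) :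
    truncatedKernelClass ν 𝓕 T cl i f g = kernelClass cl i f g g - kernelBorelClass ν 𝓕 cl i f g g := by
  rw [truncatedKernelClass_def,
    pseudoEisenstein_eq_self_of_forall_not_mem (kernelBorelTailClass_rational_borel_mul hK T) g
      (fun _ hγ => kernelBorelTailClass_of_not_lt cl i f
        (not_lt_borelHeight_mul_of_not_mem_arithmeticBorel_two hγ hT hg)),
    kernelBorelTailClass_of_lt cl i f hg]

/-- **The class window's pseudo-Eisenstein series at a point high in the cusp** (`U(J₂)`): for `1 ≤ T < H(g)`,
`Σ_δ 1_{T<H(δg)≤T'} K_{B,𝔬}(δg,δg) = 1_{H(g)≤T'} K_{B,𝔬}(g,g)`. [cite: Rogawski1990, §2.2 (p. 13)] -/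
theorem pseudoEisenstein_classWindow_eq_self_two {ν : Measure (adelicUnipotent F E c 2)}
    {𝓕 : Set (adelicUnipotent F E c 2)} {cl : (quasiSplit F E c 2).arithmeticSubgroup → ι} {i : ι}
    {f : (quasiSplit F E c 2).Adelic → ℂ}
    (hK : ∀ b ∈ arithmeticBorel F E c 2, ∀ y : (quasiSplit F E c 2).Adelic,
      kernelBorelClass ν 𝓕 cl i f ((b : (quasiSplit F E c 2).Adelic) * y)
        ((b : (quasiSplit F E c 2).Adelic) * y) = kernelBorelClass ν 𝓕 cl i f y y)
    {T T' : ℝ≥0} (hT : 1 ≤ T) (hTT' : T ≤ T') {g : (quasiSplit F E c 2).Adelic} (hg : T < borelHeight g) :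
    pseudoEisenstein ({y : (quasiSplit F E c 2).Adelic | T < borelHeight y ∧ borelHeight y ≤ T'}.indicator
        (fun y => kernelBorelClass ν 𝓕 cl i f y y)) g =
      {y : (quasiSplit F E c 2).Adelic | T < borelHeight y ∧ borelHeight y ≤ T'}.indicator
        (fun y => kernelBorelClass ν 𝓕 cl i f y y) g :=
  pseudoEisenstein_eq_self_of_forall_not_mem (classWindow_rational_borel_mul hK hTT') g
    (fun _ hγ => classWindow_of_not_lt ν 𝓕 cl i f
      (not_lt_borelHeight_mul_of_not_mem_arithmeticBorel_two hγ hT hg))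

/-- **The class window's pseudo-Eisenstein series vanishes below the cusp** (`U(J₂)`). [cite: Rogawski1990, §2.2 (p. 13)] -/
theorem pseudoEisenstein_classWindow_eq_zero_two (ν : Measure (adelicUnipotent F E c 2))
    (𝓕 : Set (adelicUnipotent F E c 2)) (cl : (quasiSplit F E c 2).arithmeticSubgroup → ι) (i : ι)
    (f : (quasiSplit F E c 2).Adelic → ℂ) {T T' : ℝ≥0} {x : (quasiSplit F E c 2).Adelic}
    (hx : ∀ γ : (quasiSplit F E c 2).arithmeticSubgroup,
      borelHeight ((γ : (quasiSplit F E c 2).Adelic) * x) ≤ T) :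
    pseudoEisenstein ({y : (quasiSplit F E c 2).Adelic | T < borelHeight y ∧ borelHeight y ≤ T'}.indicator
        (fun y => kernelBorelClass ν 𝓕 cl i f y y)) x = 0 := by
  rw [pseudoEisenstein_def]
  refine finsum_eq_zero_of_forall_eq_zero fun q => ?_
  exact classWindow_of_not_lt ν 𝓕 cl i f (not_lt.2 (hx _))

/-- **The class window's pseudo-Eisenstein series is left `G(F)`-invariant** on `U(J₂)` (★ `pseudoEisenstein_rational_mul`).
[cite: Rogawski1990, §2.2 (p. 13)] -/
theorem pseudoEisenstein_classWindow_rational_mul_two {ν : Measure (adelicUnipotent F E c 2)}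
    {𝓕 : Set (adelicUnipotent F E c 2)} {cl : (quasiSplit F E c 2).arithmeticSubgroup → ι} {i : ι}
    {f : (quasiSplit F E c 2).Adelic → ℂ}
    (hK : ∀ b ∈ arithmeticBorel F E c 2, ∀ y : (quasiSplit F E c 2).Adelic,
      kernelBorelClass ν 𝓕 cl i f ((b : (quasiSplit F E c 2).Adelic) * y)
        ((b : (quasiSplit F E c 2).Adelic) * y) = kernelBorelClass ν 𝓕 cl i f y y)
    {T T' : ℝ≥0} (hTT' : T ≤ T') (γ : (quasiSplit F E c 2).arithmeticSubgroup) (x : (quasiSplit F E c 2).Adelic) :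
    pseudoEisenstein ({y : (quasiSplit F E c 2).Adelic | T < borelHeight y ∧ borelHeight y ≤ T'}.indicator
        (fun y => kernelBorelClass ν 𝓕 cl i f y y)) ((γ : (quasiSplit F E c 2).Adelic) * x) =
      pseudoEisenstein ({y : (quasiSplit F E c 2).Adelic | T < borelHeight y ∧ borelHeight y ≤ T'}.indicator
        (fun y => kernelBorelClass ν 𝓕 cl i f y y)) x :=
  pseudoEisenstein_rational_mul (classWindow_rational_borel_mul hK hTT') γ x

/-! ## §3 `k^{T'}_𝔬 − k^{T}_𝔬` is the pseudo-Eisenstein series of the class window (`U(J₂)`) -/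

/-- **At a point with a translate above `T`** (`U(J₂)`): if `1 ≤ T ≤ T'` and `T < H(γ x)` for some `γ ∈ G(F)`, then
`k^{T'}_𝔬(x) − k^{T}_𝔬(x) = 1_{H(γx) ≤ T'} K_{B,𝔬}(γx, γx)` (move to `g = γ x` by ★ `truncatedKernelClass_rational_mul`).
[cite: Rogawski1990, §2.2 (p. 13)] -/
theorem truncatedKernelClass_sub_truncatedKernelClass_eq_of_lt_two {ν : Measure (adelicUnipotent F E c 2)}
    {𝓕 : Set (adelicUnipotent F E c 2)} {cl : (quasiSplit F E c 2).arithmeticSubgroup → ι}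
    (hcl : IsConjInvariant cl) {i : ι} {f : (quasiSplit F E c 2).Adelic → ℂ}
    (hK : ∀ b ∈ arithmeticBorel F E c 2, ∀ y : (quasiSplit F E c 2).Adelic,
      kernelBorelClass ν 𝓕 cl i f ((b : (quasiSplit F E c 2).Adelic) * y)
        ((b : (quasiSplit F E c 2).Adelic) * y) = kernelBorelClass ν 𝓕 cl i f y y)
    {T T' : ℝ≥0} (hT : 1 ≤ T) (hTT' : T ≤ T') {x : (quasiSplit F E c 2).Adelic}
    {γ : (quasiSplit F E c 2).arithmeticSubgroup} (hγ : T < borelHeight ((γ : (quasiSplit F E c 2).Adelic) * x)) :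
    truncatedKernelClass ν 𝓕 T' cl i f x - truncatedKernelClass ν 𝓕 T cl i f x =
      {y : (quasiSplit F E c 2).Adelic | T < borelHeight y ∧ borelHeight y ≤ T'}.indicator
        (fun y => kernelBorelClass ν 𝓕 cl i f y y) ((γ : (quasiSplit F E c 2).Adelic) * x) := by
  set g : (quasiSplit F E c 2).Adelic := (γ : (quasiSplit F E c 2).Adelic) * x with hg
  rw [← truncatedKernelClass_rational_mul hcl hK T γ x, ← truncatedKernelClass_rational_mul hcl hK T' γ x, ← hg,
    truncatedKernelClass_eq_kernelClass_sub_of_lt_two hK hT hγ]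
  by_cases h2 : T' < borelHeight g
  · rw [truncatedKernelClass_eq_kernelClass_sub_of_lt_two hK (hT.trans hTT') h2, sub_self,
      classWindow_of_lt ν 𝓕 cl i f h2]
  · have hle : ∀ δ : (quasiSplit F E c 2).arithmeticSubgroup,
        borelHeight ((δ : (quasiSplit F E c 2).Adelic) * g) ≤ T' := by
      intro δ
      by_cases hδ : δ ∈ arithmeticBorel F E c 2
      · obtain ⟨γ', hγ'⟩ := δ.2
        have hγ'B : (quasiSplit F E c 2).toAdelic γ' ∈ borelAdelic F E c 2 := by
          rw [hγ']; exact (mem_arithmeticBorel_iff δ).1 hδ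
        rw [← hγ', borelHeight_rational_borel_mul γ' hγ'B g]
        exact not_lt.1 h2
      · exact (not_lt.1 (not_lt_borelHeight_mul_of_not_mem_arithmeticBorel_two hδ hT hγ)).trans hTT'
    rw [truncatedKernelClass_eq_kernelClass_of_forall_le cl i f hle, sub_sub_cancel,
      classWindow_of_mem ν 𝓕 cl i f hγ (not_lt.1 h2)]

/-- **At a point with no translate above `T`** (`U(J₂)`): `k^{T'}_𝔬(x) − k^{T}_𝔬(x) = 0`. [cite: Rogawski1990, §2.2 (p. 13)] -/
theorem truncatedKernelClass_sub_truncatedKernelClass_eq_zero_two (ν : Measure (adelicUnipotent F E c 2))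
    (𝓕 : Set (adelicUnipotent F E c 2)) (cl : (quasiSplit F E c 2).arithmeticSubgroup → ι) (i : ι)
    (f : (quasiSplit F E c 2).Adelic → ℂ) {T T' : ℝ≥0} (hTT' : T ≤ T') {x : (quasiSplit F E c 2).Adelic}
    (hx : ∀ γ : (quasiSplit F E c 2).arithmeticSubgroup,
      borelHeight ((γ : (quasiSplit F E c 2).Adelic) * x) ≤ T) :
    truncatedKernelClass ν 𝓕 T' cl i f x - truncatedKernelClass ν 𝓕 T cl i f x = 0 := by
  rw [truncatedKernelClass_eq_kernelClass_of_forall_le cl i f hx,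
    truncatedKernelClass_eq_kernelClass_of_forall_le cl i f (fun γ => (hx γ).trans hTT'), sub_self]

/-- **`k^{T'}_𝔬(x) − k^{T}_𝔬(x) = Σ_{δ ∈ B(F)\G(F)} 1_{T < H(δx) ≤ T'} K_{B,𝔬}(δx, δx)`** on `U(J₂)` for `1 ≤ T ≤ T'` and
EVERY `x ∈ U(J₂)(𝔸_F)`, every class map `cl` whose fibres are unions of conjugacy classes (`hcl`) and every `i`, granted the
`B(F)`-invariance `hK` of the diagonal of `K_{B,𝔬}` — the class analogue in two variables of ★ `truncatedKernel_sub_truncatedKernel`;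
integrated and unfolded it exhibits `J^{T'}_𝔬(f) − J^{T}_𝔬(f)` as an integral of `K_{B,𝔬}` over `B(F)\G(𝔸_F) ∩ {T < H ≤ T'}`
(Arthur (1981), Prop. 2.3; Rogawski (1990), §2.3). [cite: Rogawski1990, §2.3 (p. 14)]
[cite: Arthur1981TraceFormulaInvariantForm, Prop. 2.3] -/
theorem truncatedKernelClass_sub_truncatedKernelClass_two {ν : Measure (adelicUnipotent F E c 2)}
    {𝓕 : Set (adelicUnipotent F E c 2)} {cl : (quasiSplit F E c 2).arithmeticSubgroup → ι}
    (hcl : IsConjInvariant cl) {i : ι} {f : (quasiSplit F E c 2).Adelic → ℂ}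
    (hK : ∀ b ∈ arithmeticBorel F E c 2, ∀ y : (quasiSplit F E c 2).Adelic,
      kernelBorelClass ν 𝓕 cl i f ((b : (quasiSplit F E c 2).Adelic) * y)
        ((b : (quasiSplit F E c 2).Adelic) * y) = kernelBorelClass ν 𝓕 cl i f y y)
    {T T' : ℝ≥0} (hT : 1 ≤ T) (hTT' : T ≤ T') (x : (quasiSplit F E c 2).Adelic) :
    truncatedKernelClass ν 𝓕 T' cl i f x - truncatedKernelClass ν 𝓕 T cl i f x =
      pseudoEisenstein ({y : (quasiSplit F E c 2).Adelic | T < borelHeight y ∧ borelHeight y ≤ T'}.indicator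
        (fun y => kernelBorelClass ν 𝓕 cl i f y y)) x := by
  by_cases h : ∃ γ : (quasiSplit F E c 2).arithmeticSubgroup,
      T < borelHeight ((γ : (quasiSplit F E c 2).Adelic) * x)
  · obtain ⟨γ, hγ⟩ := h
    rw [truncatedKernelClass_sub_truncatedKernelClass_eq_of_lt_two hcl hK hT hTT' hγ,
      ← pseudoEisenstein_classWindow_rational_mul_two hK hTT' γ x,
      pseudoEisenstein_classWindow_eq_self_two hK hT hTT' hγ]
  · simp only [not_exists, not_lt] at h
    rw [truncatedKernelClass_sub_truncatedKernelClass_eq_zero_two ν 𝓕 cl i f hTT' h,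
      pseudoEisenstein_classWindow_eq_zero_two ν 𝓕 cl i f h]

end Two

end UnitaryGroup

end Literature.NumberTheory.Automorphic
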